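/- Free-seat work of WIDTH SEAT 2/3 `ym-line-cbag-p1-w2` (prover-ym-line-cbag-p1-w2-g16-0), route `EguchiKawaiDirectionLadder`
(ideator ym-idea-2, LINE 8), crux `DirectionIncrement` (stmt-QuantumFields-27725), stub B1 `SingleLinkRigidity`: the deterministic
REDUCTION of B1 to an off-diagonal-block small-ball estimate.  ROUTE-INDEPENDENT (no Theses import: the conclusion is B1 spelled
out); the route-side corollaries live in `EguchiKawaiDirectionLadderSingleLinkReduction.lean`.  B1 is NOT proved here. -/
import Literature.Barriers.QuantumFields.EguchiKawaiBreakdownLowerBound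
import Literature.MeasureTheory.Group.HaarLocalChart
import HarnessLib

/-!
# Route `EguchiKawaiDirectionLadder`, stub B1 `SingleLinkRigidity` of crux `DirectionIncrement`: preliminaries

Deterministic facts every proof of the one-matrix rigidity bound B1 (`Haar{W : S_R(![U,W]) ≤ t} ≤ e^{N²(((1−2δ)/4) log t + C)}`
for centre-symmetric `U`) passes through (see the sizing note `sizing-27725-stubB1.md` attached to the item):

* `ekAction_pair_eq_frobSq` — the two-link reduced action IS the commutator: `S_R(![A, B]) = ‖AB − BA‖_F² / (2N)` (`N ≥ 1`);
* `ekAction_pair_conj` — conjugation covariance `S_R(![V U V⁻¹, W]) = S_R(![U, V⁻¹ W V])` (cyclicity of the trace), and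
  `haar_pair_conj` — the fibre measure `Haar{W : S_R(![U, W]) ≤ t}` is a class function of `U` (Haar measure of the compact group
  `U(N)` is conjugation invariant, `Literature.MeasureTheory.Group.HaarLocalChart.measurePreserving_conj`);
* `frobSq_diagonal_comm` — in an eigenbasis, `‖DW − WD‖_F² = Σ_{j,k} |d_j − d_k|² |W_{jk}|²` for `D = diagonal d`;
* `frobSq_diagonal_comm_ge_blocks` — the BLOCK LOWER BOUND: if a labelling `ℓ : Fin N → Option (Fin m)` of the indices satisfies
  `|d_j − d_k|² ≥ γ` whenever `ℓ j ≠ ℓ k` are both blocks (`some`), then `‖DW − WD‖_F² ≥ γ · Σ_{ℓ j ≠ ℓ k, both some} |W_{jk}|²`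
  (the unlabelled indices — the collars — are free);
* `measure_le_exp_of_le` — the trivial regime: for `t ≥ t₀` the bound `e^{N²(κ log t + C)}` holds as soon as `C ≥ κ log(1/t₀)`.

Main result `singleLinkRigidity_of_blocks_of_offDiagSmallBall`: B1 (spelled out) follows from (RMT) an `N`-uniform small-ball
bound `Haar{W : offDiagBlockSq ℓ W ≤ N s} ≤ e^{C_m N²} s^{labelPairCount ℓ/2}` for the off-diagonal blocks of a Haar unitary and
(BLOCKS) a choice of blocks from `|tr U/N|² ≤ δ` with `|d_j − d_k|² ≥ γ` across blocks and `labelPairCount/2 ≥ ((1−2δ)/4)N²`; the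
route-side file `EguchiKawaiDirectionLadderSingleLinkReduction.lean` turns this into the registered stub name and the crux.  Also
`exists_unitary_conj_eq_diagonal` (every unitary matrix is unitarily diagonalisable, via `e^{i arg U}` and the Hermitian spectral theorem).

HONEST FRAMING.  Bookkeeping toward B1; the random-matrix core (an `N`-uniform small-ball bound for the off-diagonal blocks of a
Haar unitary, Szarek-type Hilbert–Schmidt metric entropy of `U(N)/(U(n₁)×…×U(n_m))`) and the choice of blocks from `|tr U/N|² ≤ δ`
are NOT in this file.  The route bears on the barrier-ledger fact `EguchiKawaiBreakdown`; nothing here bears on the Yang–Mills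
mass gap.
-/

set_option autoImplicit false

noncomputable section

open MeasureTheory
open scoped Matrix ENNReal Matrix.Norms.L2Operator
open Literature.Barriers.QuantumFields

namespace Summit.QuantumFields.YangMills.Theorems.EguchiKawaiDirectionLadder

variable {N : ℕ}

/-! ### The two-link action is the commutator -/

/-- `frobSq (−M) = frobSq M`. -/
theorem frobSq_neg (M : Matrix (Fin N) (Fin N) ℂ) : frobSq (-M) = frobSq M := by
  simp [frobSq]

/-- The commutator Frobenius norm is symmetric: `‖BA − AB‖_F² = ‖AB − BA‖_F²`. -/
theorem frobSq_comm_symm (A B : Matrix (Fin N) (Fin N) ℂ) : frobSq (B * A - A * B) = frobSq (A * B - B * A) := by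
  rw [← frobSq_neg, neg_sub]

/-- **The two-link reduced action is the commutator**: for `N ≥ 1` and `A, B ∈ U(N)`,
`S_R(![A, B]) = ‖AB − BA‖_F² / (2N)` (Makeenko (14.38) ↔ (14.55) for `d = 2`). -/
theorem ekAction_pair_eq_frobSq (hN : 0 < N) (A B : UN N) :
    ekAction (![A, B] : EKConfig 2 N) =
      frobSq ((A : Matrix (Fin N) (Fin N) ℂ) * (B : Matrix (Fin N) (Fin N) ℂ) -
          (B : Matrix (Fin N) (Fin N) ℂ) * (A : Matrix (Fin N) (Fin N) ℂ)) / (2 * N) := by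
  rw [ekAction_eq_sum_ekCommNormSq hN]
  have h01 : ekCommNormSq (![A, B] : EKConfig 2 N) 0 1 =
      frobSq ((A : Matrix (Fin N) (Fin N) ℂ) * (B : Matrix (Fin N) (Fin N) ℂ) -
        (B : Matrix (Fin N) (Fin N) ℂ) * (A : Matrix (Fin N) (Fin N) ℂ)) := by
    rw [ekCommNormSq_eq_frobSq]; rfl
  have h10 : ekCommNormSq (![A, B] : EKConfig 2 N) 1 0 =
      frobSq ((A : Matrix (Fin N) (Fin N) ℂ) * (B : Matrix (Fin N) (Fin N) ℂ) -
        (B : Matrix (Fin N) (Fin N) ℂ) * (A : Matrix (Fin N) (Fin N) ℂ)) := by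
    rw [ekCommNormSq_eq_frobSq, ← frobSq_comm_symm]; rfl
  simp only [Fin.sum_univ_two, ekCommNormSq_self, h01, h10, zero_div, zero_add, add_zero]
  have hN' : (N : ℝ) ≠ 0 := by exact_mod_cast hN.ne'
  field_simp
  ring

/-! ### Conjugation covariance -/

/-- The plaquette trace of the pair `(V U V⁻¹, W)` equals that of `(U, V⁻¹ W V)` (cyclicity of the trace). -/
theorem ekPlaqTrace_pair_conj (U V W : UN N) :
    ekPlaqTrace (![V * U * V⁻¹, W] : EKConfig 2 N) 0 1 = ekPlaqTrace (![U, V⁻¹ * W * V] : EKConfig 2 N) 0 1 := by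
  simp only [ekPlaqTrace, Matrix.cons_val_zero, Matrix.cons_val_one, Matrix.UnitaryGroup.mul_val,
    Matrix.UnitaryGroup.inv_val, Matrix.star_eq_conjTranspose, Matrix.conjTranspose_mul,
    Matrix.conjTranspose_conjTranspose, Matrix.mul_assoc]
  conv_rhs => rw [Matrix.trace_mul_comm]
  simp only [Matrix.mul_assoc]

/-- **Conjugation covariance of the two-link action**: `S_R(![V U V⁻¹, W]) = S_R(![U, V⁻¹ W V])`. -/
theorem ekAction_pair_conj (U V W : UN N) :
    ekAction (![V * U * V⁻¹, W] : EKConfig 2 N) = ekAction (![U, V⁻¹ * W * V] : EKConfig 2 N) := by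
  -- both actions are `1 − Re tr(plaquette)/N` by `ekAction_pair` of the Fubini file; we redo the two-term sum here
  have hsum : ∀ X : EKConfig 2 N, ekAction X =
      (1 - (ekPlaqTrace X 0 1).re / N) / 2 + (1 - (ekPlaqTrace X 1 0).re / N) / 2 := by
    intro X; simp [ekAction, Fin.sum_univ_two]
  have hre : ∀ X : EKConfig 2 N, (ekPlaqTrace X 1 0).re = (ekPlaqTrace X 0 1).re := by
    intro X
    have h1 := ekCommNormSq_eq X 1 0
    have h2 := ekCommNormSq_eq X 0 1
    have h3 : ekCommNormSq X 1 0 = ekCommNormSq X 0 1 := by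
      rw [ekCommNormSq_eq_frobSq, ekCommNormSq_eq_frobSq, ekComm, ekComm, frobSq_comm_symm]
    linarith
  rw [hsum, hsum, hre, hre, ekPlaqTrace_pair_conj]

/-- `haarProbability (UN N)` is a Haar measure (it is `haarMeasure ⊤`); recorded as a theorem, used via `haveI`. -/
theorem isHaarMeasure_haarProbability :
    (Literature.MathematicalPhysics.QuantumFieldTheory.haarProbability (UN N)).IsHaarMeasure := by
  dsimp [Literature.MathematicalPhysics.QuantumFieldTheory.haarProbability]; infer_instance

/-- **The fibre measure is a class function of `U`**: `Haar{W : S_R(![V U V⁻¹, W]) ≤ t} = Haar{W : S_R(![U, W]) ≤ t}` (the Haar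
measure of the compact group `U(N)` is invariant under `W ↦ V⁻¹ W V`). -/
theorem haar_pair_conj (U V : UN N) (t : ℝ) :
    Literature.MathematicalPhysics.QuantumFieldTheory.haarProbability (UN N)
        {W : UN N | ekAction (![V * U * V⁻¹, W] : EKConfig 2 N) ≤ t} =
      Literature.MathematicalPhysics.QuantumFieldTheory.haarProbability (UN N)
        {W : UN N | ekAction (![U, W] : EKConfig 2 N) ≤ t} := by
  set μ := Literature.MathematicalPhysics.QuantumFieldTheory.haarProbability (UN N) with hμ
  haveI : μ.IsHaarMeasure := isHaarMeasure_haarProbability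
  have hmp : MeasurePreserving (fun W : UN N => V⁻¹ * W * V⁻¹⁻¹) μ μ :=
    Literature.MeasureTheory.Group.HaarLocalChart.measurePreserving_conj μ V⁻¹
  have hset : {W : UN N | ekAction (![V * U * V⁻¹, W] : EKConfig 2 N) ≤ t} =
      (fun W : UN N => V⁻¹ * W * V⁻¹⁻¹) ⁻¹' {W : UN N | ekAction (![U, W] : EKConfig 2 N) ≤ t} := by
    ext W
    simp only [Set.mem_setOf_eq, Set.mem_preimage, inv_inv, ekAction_pair_conj]
  have hmeas : MeasurableSet {W : UN N | ekAction (![U, W] : EKConfig 2 N) ≤ t} := by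
    refine (isClosed_le ?_ continuous_const).measurableSet
    refine continuous_ekAction.comp (continuous_pi fun i => ?_)
    fin_cases i <;> simp <;> fun_prop
  rw [hset, hmp.measure_preimage hmeas.nullMeasurableSet]

/-! ### The commutator with a diagonal matrix, and the block lower bound -/

/-- In an eigenbasis the commutator is entrywise: `‖DW − WD‖_F² = Σ_{j,k} |d_j − d_k|²·|W_{jk}|²` for `D = diagonal d`. -/
theorem frobSq_diagonal_comm (d : Fin N → ℂ) (W : Matrix (Fin N) (Fin N) ℂ) :
    frobSq (Matrix.diagonal d * W - W * Matrix.diagonal d) = ∑ j, ∑ k, ‖d j - d k‖ ^ 2 * ‖W j k‖ ^ 2 := by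
  unfold frobSq
  refine Finset.sum_congr rfl fun j _ => Finset.sum_congr rfl fun k _ => ?_
  rw [Matrix.sub_apply, Matrix.diagonal_mul, Matrix.mul_diagonal, ← mul_pow, ← norm_mul]
  congr 2
  ring

/-- The off-diagonal-block Frobenius mass of `W` for a labelling `ℓ` of the indices by `m` blocks (`none` = free index):
`offDiagBlockSq ℓ W = Σ_{j,k : ℓ j ≠ ℓ k, ℓ j ≠ none, ℓ k ≠ none} |W_{jk}|²`.  (An abbreviation used only inside this reduction; the
random-matrix core bounds the Haar measure of `{offDiagBlockSq ℓ W ≤ N s}`.) -/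
def offDiagBlockSq {m : ℕ} (ℓ : Fin N → Option (Fin m)) (W : Matrix (Fin N) (Fin N) ℂ) : ℝ :=
  ∑ j, ∑ k, if ℓ j ≠ ℓ k ∧ ℓ j ≠ none ∧ ℓ k ≠ none then ‖W j k‖ ^ 2 else 0

/-- **Block lower bound**: if `|d_j − d_k|² ≥ γ` whenever `j`, `k` carry different block labels, then
`‖DW − WD‖_F² ≥ γ · offDiagBlockSq ℓ W` (`D = diagonal d`). -/
theorem frobSq_diagonal_comm_ge_blocks {m : ℕ} (ℓ : Fin N → Option (Fin m)) {d : Fin N → ℂ} {γ : ℝ}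
    (hsep : ∀ j k, ℓ j ≠ ℓ k → ℓ j ≠ none → ℓ k ≠ none → γ ≤ ‖d j - d k‖ ^ 2)
    (W : Matrix (Fin N) (Fin N) ℂ) :
    γ * offDiagBlockSq ℓ W ≤ frobSq (Matrix.diagonal d * W - W * Matrix.diagonal d) := by
  rw [frobSq_diagonal_comm, offDiagBlockSq, Finset.mul_sum]
  refine Finset.sum_le_sum fun j _ => ?_
  rw [Finset.mul_sum]
  refine Finset.sum_le_sum fun k _ => ?_
  split_ifs with h
  · exact mul_le_mul_of_nonneg_right (hsep j k h.1 h.2.1 h.2.2) (by positivity)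
  · rw [mul_zero]; positivity

/-! ### The trivial regime `t ≥ t₀` -/

/-- For `t ≥ t₀ > 0`, `κ ≥ 0` and `C ≥ κ·log(1/t₀)`, any probability is `≤ exp(N²(κ log t + C))`. -/
theorem measure_le_exp_of_le {α : Type*} [MeasurableSpace α] (μ : Measure α) [IsProbabilityMeasure μ] (s : Set α)
    {t t₀ κ C : ℝ} (ht₀ : 0 < t₀) (ht : t₀ ≤ t) (hκ : 0 ≤ κ) (hC : κ * Real.log (1 / t₀) ≤ C) (N : ℕ) :
    μ s ≤ ENNReal.ofReal (Real.exp ((N : ℝ) ^ 2 * (κ * Real.log t + C))) := by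
  have h1 : μ s ≤ 1 := prob_le_one
  refine h1.trans ?_
  rw [← ENNReal.ofReal_one]
  apply ENNReal.ofReal_le_ofReal
  rw [Real.one_le_exp_iff]
  apply mul_nonneg (by positivity)
  have hlog : Real.log t₀ ≤ Real.log t := Real.log_le_log ht₀ ht
  have hlog' : Real.log (1 / t₀) = -Real.log t₀ := by rw [one_div, Real.log_inv]
  rw [hlog'] at hC
  nlinarith [mul_le_mul_of_nonneg_left hlog hκ]

/-! ### Unitary diagonalisation -/

/-- **Every unitary matrix is unitarily diagonalisable**: `V⁻¹ U V = diagonal d` for some `V ∈ U(N)` (proof: `U = e^{iH}` with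
`H = arg U` Hermitian by the continuous functional calculus — the tree's `exists_uCoords_eq` — and `H = V Λ V⋆` by Mathlib's spectral
theorem, so `V⋆ U V = e^{iΛ}` is diagonal, `Matrix.exp_conj'`, `Matrix.exp_diagonal`). -/
theorem exists_unitary_conj_eq_diagonal (U : UN N) :
    ∃ V : UN N, ∃ d : Fin N → ℂ, ((V⁻¹ * U * V : UN N) : Matrix (Fin N) (Fin N) ℂ) = Matrix.diagonal d := by
  letI : CStarAlgebra (Matrix (Fin N) (Fin N) ℂ) := {}
  obtain ⟨x, -, hx⟩ := exists_uCoords_eq U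
  have hH : Matrix.IsHermitian (uHerm x) := uHerm_isHermitian x
  set V : UN N := hH.eigenvectorUnitary with hV
  refine ⟨V, ?_⟩
  have hU : (U : Matrix (Fin N) (Fin N) ℂ) = NormedSpace.exp (Complex.I • uHerm x) := by
    rw [← hx]; rfl
  have hdiag : star (V : Matrix (Fin N) (Fin N) ℂ) * uHerm x * (V : Matrix (Fin N) (Fin N) ℂ) =
      Matrix.diagonal (RCLike.ofReal ∘ hH.eigenvalues) := by
    have h := hH.conjStarAlgAut_star_eigenvectorUnitary
    rw [Unitary.conjStarAlgAut_star_apply] at h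
    exact h
  have hunit : IsUnit (V : Matrix (Fin N) (Fin N) ℂ) := Unitary.isUnit_coe
  have hinv : (V : Matrix (Fin N) (Fin N) ℂ)⁻¹ = star (V : Matrix (Fin N) (Fin N) ℂ) := by
    rw [Matrix.inv_eq_left_inv (Matrix.UnitaryGroup.star_mul_self V)]
  have key : star (V : Matrix (Fin N) (Fin N) ℂ) * NormedSpace.exp (Complex.I • uHerm x) * (V : Matrix (Fin N) (Fin N) ℂ) =
      NormedSpace.exp (star (V : Matrix (Fin N) (Fin N) ℂ) * (Complex.I • uHerm x) * (V : Matrix (Fin N) (Fin N) ℂ)) := by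
    rw [← hinv]
    exact (Matrix.exp_conj' _ _ hunit).symm
  rw [Matrix.UnitaryGroup.mul_val, Matrix.UnitaryGroup.mul_val, Matrix.UnitaryGroup.inv_val, hU, key, Matrix.mul_smul,
    Matrix.smul_mul, hdiag, ← Matrix.diagonal_smul, Matrix.exp_diagonal]
  exact ⟨_, rfl⟩

/-- The diagonal entries of a diagonal unitary matrix have modulus one. -/
theorem norm_eq_one_of_coe_eq_diagonal {D : UN N} {d : Fin N → ℂ}
    (hD : (D : Matrix (Fin N) (Fin N) ℂ) = Matrix.diagonal d) (j : Fin N) : ‖d j‖ = 1 := by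
  have h := Matrix.UnitaryGroup.star_mul_self D
  rw [show D.1 = (D : Matrix (Fin N) (Fin N) ℂ) from rfl, hD, Matrix.star_eq_conjTranspose,
    Matrix.diagonal_conjTranspose, Matrix.diagonal_mul_diagonal, ← Matrix.diagonal_one, Matrix.diagonal_eq_diagonal_iff] at h
  have hj := h j
  rw [Pi.star_apply, Complex.star_def, Complex.conj_mul'] at hj
  have h2 : ‖d j‖ ^ 2 = 1 := by exact_mod_cast hj
  nlinarith [norm_nonneg (d j)]

/-- The trace is a class function: `tr(V⁻¹ U V) = tr U`, so a diagonalisation has `Σ_j d_j = tr U`. -/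
theorem sum_eq_trace_of_coe_eq_diagonal {U V : UN N} {d : Fin N → ℂ}
    (hD : ((V⁻¹ * U * V : UN N) : Matrix (Fin N) (Fin N) ℂ) = Matrix.diagonal d) :
    ∑ j, d j = Matrix.trace (U : Matrix (Fin N) (Fin N) ℂ) := by
  rw [← Matrix.trace_diagonal, ← hD, Matrix.UnitaryGroup.mul_val, Matrix.UnitaryGroup.mul_val, Matrix.UnitaryGroup.inv_val,
    Matrix.trace_mul_cycle, show V.1 = (V : Matrix (Fin N) (Fin N) ℂ) from rfl,
    Matrix.mem_unitaryGroup_iff.1 V.2, Matrix.one_mul]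

/-! ### The reduction: B1 from a block choice and an off-diagonal-block small-ball bound -/

/-- The number of ORDERED index pairs `(j, k)` carrying two different block labels (free indices excluded); for block sizes
`n_i` this is `Σ_{i ≠ i'} n_i n_{i'} = 2 Σ_{i<i'} n_i n_{i'}`, twice the real codimension count of the block-diagonal subgroup. -/
def labelPairCount {m : ℕ} (ℓ : Fin N → Option (Fin m)) : ℕ :=
  (Finset.univ.filter fun p : Fin N × Fin N => ℓ p.1 ≠ ℓ p.2 ∧ ℓ p.1 ≠ none ∧ ℓ p.2 ≠ none).card

/-- **B1 reduced to its two inputs.**  Suppose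
(RMT) an `N`-uniform small-ball bound for the off-diagonal blocks of a Haar unitary: for every number of blocks `m` a constant
`C_m ≥ 0` with `Haar{W : offDiagBlockSq ℓ W ≤ N·s} ≤ e^{C_m N²} · s^{labelPairCount ℓ / 2}` for every labelling `ℓ` and `0 < s ≤ 1`
(Hilbert–Schmidt metric entropy of `U(N)/(U(n₁)×…×U(n_m))`, Szarek 1998; NOT proved in the tree), and
(BLOCKS) a block choice from centre symmetry: for `0 < δ < 1/2` some `m`, `γ > 0` such that every unit-modulus spectrum `d` with
`|Σ_j d_j / N|² ≤ δ` admits a labelling with `|d_j − d_k|² ≥ γ` across blocks and `labelPairCount ℓ / 2 ≥ ((1 − 2δ)/4)·N²`.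
Then `SingleLinkRigidity` holds (spelled out; `pairConfig U W = ![U, W]`), with `C = C_m + ((1−2δ)/4)·log(2/γ')`, `γ' = min γ 1`,
`N₀ = 1`.  Proof: diagonalise `U` (class-function property of the fibre measure), `S_R(![D,W]) = ‖DW − WD‖_F²/(2N) ≥ γ·offDiagBlockSq/(2N)`,
apply (RMT) with `s = 2t/γ'`, and compare exponents (`s ≤ 1`); `t ≥ γ'/2` is the trivial regime. -/
theorem singleLinkRigidity_of_blocks_of_offDiagSmallBall
    (hRMT : ∀ m : ℕ, ∃ Cm : ℝ, 0 ≤ Cm ∧ ∀ N : ℕ, ∀ ℓ : Fin N → Option (Fin m), ∀ s : ℝ, 0 < s → s ≤ 1 →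
      Literature.MathematicalPhysics.QuantumFieldTheory.haarProbability (UN N)
          {W : UN N | offDiagBlockSq ℓ (W : Matrix (Fin N) (Fin N) ℂ) ≤ N * s} ≤
        ENNReal.ofReal (Real.exp (Cm * (N : ℝ) ^ 2) * s ^ ((labelPairCount ℓ : ℝ) / 2)))
    (hblocks : ∀ δ : ℝ, 0 < δ → δ < 1 / 2 → ∃ m : ℕ, ∃ γ : ℝ, 0 < γ ∧ ∀ N : ℕ, ∀ d : Fin N → ℂ,
      (∀ j, ‖d j‖ = 1) → ‖(∑ j, d j) / (N : ℂ)‖ ^ 2 ≤ δ → ∃ ℓ : Fin N → Option (Fin m),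
        (∀ j k, ℓ j ≠ ℓ k → ℓ j ≠ none → ℓ k ≠ none → γ ≤ ‖d j - d k‖ ^ 2) ∧
          (1 - 2 * δ) / 4 * (N : ℝ) ^ 2 ≤ (labelPairCount ℓ : ℝ) / 2) :
    ∀ δ : ℝ, 0 < δ → δ < 1 / 2 → ∃ C : ℝ, 0 ≤ C ∧ ∃ N₀ : ℕ, ∀ N : ℕ, N₀ ≤ N → ∀ U : UN N,
      ‖Matrix.trace (U : Matrix (Fin N) (Fin N) ℂ) / (N : ℂ)‖ ^ 2 ≤ δ → ∀ t : ℝ, 0 < t →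
        Literature.MathematicalPhysics.QuantumFieldTheory.haarProbability (UN N)
            {W : UN N | ekAction (![U, W] : EKConfig 2 N) ≤ t} ≤
          ENNReal.ofReal (Real.exp ((N : ℝ) ^ 2 * ((1 - 2 * δ) / 4 * Real.log t + C))) := by
  intro δ hδ hδ'
  obtain ⟨m, γ₀, hγ₀, hbl⟩ := hblocks δ hδ hδ'
  obtain ⟨Cm, hCm, hrmt⟩ := hRMT m
  -- work with γ = min γ₀ 1 ≤ 1 so that log(2/γ) ≥ 0
  set γ : ℝ := min γ₀ 1 with hγdef
  have hγ : 0 < γ := lt_min hγ₀ one_pos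
  have hγ1 : γ ≤ 1 := min_le_right _ _
  have hγle : γ ≤ γ₀ := min_le_left _ _
  set κ : ℝ := (1 - 2 * δ) / 4 with hκ
  have hκ0 : 0 ≤ κ := by rw [hκ]; linarith
  have hlog2γ : 0 ≤ Real.log (2 / γ) := Real.log_nonneg (by rw [le_div_iff₀ hγ]; linarith)
  refine ⟨Cm + κ * Real.log (2 / γ), by positivity, 1, fun N hN U hU t ht => ?_⟩
  set μ := Literature.MathematicalPhysics.QuantumFieldTheory.haarProbability (UN N) with hμ
  have hNpos : (0 : ℝ) < N := by exact_mod_cast hN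
  by_cases hlt : t < γ / 2
  · -- main regime: s = 2t/γ ∈ (0, 1)
    set s : ℝ := 2 * t / γ with hs
    have hs0 : 0 < s := by positivity
    have hs1 : s ≤ 1 := by rw [hs, div_le_one hγ]; linarith
    -- diagonalise
    obtain ⟨V, d, hVd⟩ := exists_unitary_conj_eq_diagonal U
    have hd1 : ∀ j, ‖d j‖ = 1 := norm_eq_one_of_coe_eq_diagonal hVd
    have htr : ‖(∑ j, d j) / (N : ℂ)‖ ^ 2 ≤ δ := by rw [sum_eq_trace_of_coe_eq_diagonal hVd]; exact hU
    obtain ⟨ℓ, hsep, hexp⟩ := hbl N d hd1 htr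
    set D : UN N := V⁻¹ * U * V with hDdef
    have hUD : U = V * D * V⁻¹ := by rw [hDdef]; group
    -- the event is contained in the block event for D
    have hsub : {W : UN N | ekAction (![D, W] : EKConfig 2 N) ≤ t} ⊆
        {W : UN N | offDiagBlockSq ℓ (W : Matrix (Fin N) (Fin N) ℂ) ≤ N * s} := by
      intro W hW
      have hW' : ekAction (![D, W] : EKConfig 2 N) ≤ t := hW
      rw [ekAction_pair_eq_frobSq hN, hVd] at hW'
      have hblk := frobSq_diagonal_comm_ge_blocks ℓ (d := d) (γ := γ)
        (fun j k h1 h2 h3 => hγle.trans (hsep j k h1 h2 h3)) (W : Matrix (Fin N) (Fin N) ℂ)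
      have hle : frobSq (Matrix.diagonal d * (W : Matrix (Fin N) (Fin N) ℂ) -
          (W : Matrix (Fin N) (Fin N) ℂ) * Matrix.diagonal d) ≤ 2 * N * t := by
        rwa [div_le_iff₀ (by positivity), mul_comm] at hW'
      show offDiagBlockSq ℓ (W : Matrix (Fin N) (Fin N) ℂ) ≤ N * s
      rw [hs, mul_div_assoc', le_div_iff₀ hγ]
      nlinarith
    -- exponent comparison
    have hpow : s ^ ((labelPairCount ℓ : ℝ) / 2) ≤ s ^ (κ * (N : ℝ) ^ 2) :=
      Real.rpow_le_rpow_of_exponent_ge hs0 hs1 hexp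
    calc μ {W : UN N | ekAction (![U, W] : EKConfig 2 N) ≤ t}
        = μ {W : UN N | ekAction (![D, W] : EKConfig 2 N) ≤ t} := by rw [hUD]; exact haar_pair_conj D V t
      _ ≤ μ {W : UN N | offDiagBlockSq ℓ (W : Matrix (Fin N) (Fin N) ℂ) ≤ N * s} := measure_mono hsub
      _ ≤ ENNReal.ofReal (Real.exp (Cm * (N : ℝ) ^ 2) * s ^ ((labelPairCount ℓ : ℝ) / 2)) := hrmt N ℓ s hs0 hs1
      _ ≤ ENNReal.ofReal (Real.exp (Cm * (N : ℝ) ^ 2) * s ^ (κ * (N : ℝ) ^ 2)) := by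
          apply ENNReal.ofReal_le_ofReal; gcongr
      _ = ENNReal.ofReal (Real.exp ((N : ℝ) ^ 2 * (κ * Real.log t + (Cm + κ * Real.log (2 / γ))))) := by
          congr 1
          rw [Real.rpow_def_of_pos hs0, ← Real.exp_add]
          congr 1
          have hlogs : Real.log s = Real.log t + Real.log (2 / γ) := by
            rw [hs, show 2 * t / γ = t * (2 / γ) by ring, Real.log_mul ht.ne' (by positivity)]
          rw [hlogs]; ring
  · -- trivial regime t ≥ γ/2
    push Not at hlt
    haveI : IsProbabilityMeasure μ := by rw [hμ]; infer_instance
    refine measure_le_exp_of_le μ _ (t₀ := γ / 2) (by positivity) hlt hκ0 ?_ N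
    rw [one_div, inv_div]
    nlinarith [mul_nonneg hκ0 hlog2γ]

end Summit.QuantumFields.YangMills.Theorems.EguchiKawaiDirectionLadder

end
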